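/-
Copyright (c) 2026 the pub-hodgecm-mathlib formalisation cell (harness21).  Prover seat hodgecm-mathlib-LH10-p02 (g14), 2026-09-03.  E1 row 55 «HOROCYCLE ∕ HEIGHT
GEOMETRY OF THE U(3) TREE AT THE DATUM», file B-1 «HOROCYCLES AT THE DATUM» (keeper F0P3a-p03 (g30) 03:20:54Z; census `CENSUS-R55.v1` c3e3dfd81a9bbf59; consumer census
`CENSUS-R61.v1` deab954e1f643c59 (F0P2-p06 (g22)) §2 (X1)(X2)).
-/
import Literature.NumberTheory.Rogawski1990.CMLocalAPacketMembers                   -- ★ `Gqs L v`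
import Literature.NumberTheory.Automorphic.CMLocalNonsplitBorelTransport             -- ★ `localNonsplitEquiv_mem_unipotentU_iff ∕ _mem_torusU_iff`, `localNonsplitEquiv_apply_apply`
import Literature.NumberTheory.Automorphic.UnitaryLatticeTreeHorosphereTransversal   -- ★ A-II p853487 (LH5-p05): (H5)–(H8); brings ★ A-I `…HorocycleSteps` (this seat): (T)(T′)(H1)(H4)
import Literature.NumberTheory.Automorphic.UnitaryGroupRankOneBigCell               -- ★ `mul_comm_of_mem_torusU`
import Literature.NumberTheory.Automorphic.UnitaryLatticeTreeLevelGroupsPackage      -- ★ 41g-P: `isCompact_setOf_latticeGraphIso_apply_eq`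
import Literature.NumberTheory.Automorphic.AdicCompletionCompact                   -- ★ `compactSpace_integer_adicCompletion`
import Literature.NumberTheory.Automorphic.CMTorusRegularAEPrelims                 -- ★ `isClosed_torusU_of_t1Space`
import HarnessLib

/-!
# F0 · P3c · E1 row 55 — HOROCYCLES OF THE `U(3)` TREE AT THE CM DATUM: the Borel pair of `Gqs L v` along the one-place model `eA`, the torus translation `τ`, the compact torus
# `T ∩ Stab(A 0)`, and the `N(L⁺_v)`-invariant horocycle index of vertices and edges (Bruhat–Tits 1972 §10; Serre *Trees* II.1.1; Rogawski 1990 §1.10, §4.5)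

Cell `pub/hodgecm-mathlib`, crux H413 = `stmt-HodgeConjecture-24833` (`--supports` lane, helper, THEOREMS ONLY: no definition ∕ instance ∕ notation ∕ named fact ∕ `sorry`).
Namespace `Summit.HodgeConjecture.HodgeConjecture.Cruxes.H413.F0P3cStCharTSHorocyclesAtDatum`.  E1 BRICK LEDGER row 55 (keeper F0P3a-p03 (g30)), file B-1 of the datum side:
the generic lattice-tree results ★ A-I `UnitaryLatticeTreeHorocycleSteps` (this seat) and ★ A-II `UnitaryLatticeTreeHorosphereTransversal` (LH5-p05 (g12)) pulled back to
`Γ := Gqs L v = U(Φ₃)(L⁺_v)` along the (G3)-EXPLICIT one-place model `eA : Gqs L v ≃ₜ* U(σ_w, J₀)(L_w)` (`heA`: its matrices are those of ★ `localNonsplitEquiv`), with the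
Borel triple `t := cmBorelTriple L 3 v` (every Borel letter is spelt `(cmBorelTriple L 3 v : ParabolicTriple (Gqs L v)).P ∕ .M ∕ .N`, so that ★ 5b `sum_finrank_block_eigen_eq_of_tree`
instantiates at `t := cmBorelTriple L 3 v` on the nose) and the tree action `a g = latticeGraphIso σ_w ϖ J₀ (eA g)` (41g-H ∕ 48-datum letter `ha`); the apartment
`A : ℤ → 𝓥` is hypothesis-style `(A, hA0, hA1)` as in ★ 39γ.  HONEST LABEL: count-neutral datum helper ((R-SS) banked as a PAYDOWN-UNR road for K1 only; E1 = PRINT); HC_CM is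
proved only modulo the 7 printed citations (2 remaining named inputs hLiu418 = `stmt-HodgeConjecture-24832`, h413 = `stmt-HodgeConjecture-24833`) until rung 0 closes.

* §1 TRANSPORT: `g ∈ t.N ∕ t.M ∕ t.P ↔ eA g ∈ unipotentU ∕ torusU ∕ borelU` (★ `CMLocalNonsplitBorelTransport` + `heA`).
* §2 TORUS LETTERS: **(X0)** `exists_mem_cmBorelTriple_M_apartmentEnum_eq_add_two` — `τ ∈ t.M`, `eA τ = diag(ϖ,1,ϖ⁻¹)`, `τ · A j = A (j+2)` (the `τM hτM` letters of ★ 5b);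
  `mul_comm_of_mem_cmBorelTriple_M` (`hCτ`); `apartmentEnum_eq_self_of_mem_cmBorelTriple_M_of_apply_zero` ∕ `mapEdgeSet_…` (a torus element fixing `A 0` fixes the apartment:
  `hCR₀ ∕ hCR₁` for `C := t.M ⊓ Stab(A 0)`); `isCompact_cmBorelTriple_M_inf` (`hC`).
* §3 **(X1v)(X1e)** `exists_horocycleIndex_vertices ∕ _edges`: `idx : 𝓥 → ℤ`, `tr : 𝓥 → N(L⁺_v)` with `tr x · A (idx x) = x`, `idx` invariant under `N(L⁺_v)`, `idx (A j) = j`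
  (and the edge twin in `mapEdgeSet` currency) — ★ A-II (H5)(H6!)(H7e)(H7!e) along `eA`.
The assembled `rep ∕ tr ∕ ht ∕ S` letters of ★ 5b are file B-2 `F0P3cStCharTSHorocycleDataAtDatum`; the (α) Borel double-coset packages are file B-3.

## References
* [BruhatTits1972] F. Bruhat, J. Tits, *Groupes réductifs sur un corps local I*, Publ. Math. IHÉS 41 (1972), §10, (4.4.3)–(4.4.4).
* [Serre1980Trees] J.-P. Serre, *Trees* (1980), Ch. II §1.1, Ch. I §6.4.
* [Rogawski1990] J. D. Rogawski, *Automorphic Representations of Unitary Groups in Three Variables*, Ann. of Math. Stud. 123 (1990), §1.10 p. 9 (`B = MN`), §4.5 p. 45 (Iwasawa),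
  §12.2 p. 173.
* [PlatonovRapinchuk1994] V. Platonov, A. Rapinchuk, *Algebraic Groups and Number Theory* (1994), §5.1 (the one-place model at a non-split place).
* [Casselman1995] W. Casselman, *Introduction to the theory of admissible representations of p-adic reductive groups* (1995), §6.3.
-/

set_option autoImplicit false
-- the mandated namespace has the single-problem summit's repeated segment (`HodgeConjecture.HodgeConjecture`)
set_option linter.dupNamespace false

noncomputable section

open NumberField IsDedekindDomain
open scoped Valued WithZero Matrix MatrixGroups
open Literature.NumberTheory.Rogawski1990 Literature.NumberTheory.Automorphic Literature.NumberTheory.Automorphic.UnitaryGroup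
open Literature.NumberTheory.Automorphic.UnitaryLatticeTree Literature.NumberTheory.Automorphic.HermitianLattice

namespace Summit.HodgeConjecture.HodgeConjecture.Cruxes.H413.F0P3cStCharTSHorocyclesAtDatum

/-! ## §1 The one-place model `eA` carries `B = T·N` of `Gqs L v` onto the upper-triangular Borel pair of `U(σ_w, J₀)(L_w)` -/

section Transport

variable (L : Type) [Field L] [NumberField L] [IsCMField L] (v : HeightOneSpectrum (𝓞 ↥(maximalRealSubfield L)))
  (w : PlacesOver L v) (hw : IsCMField.complexConj L • w.1 = w.1)
  (eA : Gqs L v ≃ₜ* ↥(unitaryGroupOfForm (galAdicCompletionMap (L := L) (IsCMField.complexConj L) hw) ((StdForm.antidiagonal 3).over (w.1.adicCompletion L))))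
  (heA : ∀ g : Gqs L v,
    ((eA g : ↥(unitaryGroupOfForm (galAdicCompletionMap (L := L) (IsCMField.complexConj L) hw) ((StdForm.antidiagonal 3).over (w.1.adicCompletion L)))) :
        GL (Fin 3) (w.1.adicCompletion L)) =
      ((localNonsplitEquiv (IsCMField.complexConj L) (qsForm L) (IsCMField.complexConj_ne_one L) w hw g :
        ↥(unitaryGroupOfForm (galAdicCompletionMap (L := L) (IsCMField.complexConj L) hw) (placeForm (qsForm L) w.1))) : GL (Fin 3) (w.1.adicCompletion L)))
include heA

/-- **Radical ↔ radical along `eA`**: `g ∈ N(L⁺_v) = (cmBorelTriple L 3 v).N ↔ eA g` is upper unitriangular (★ `localNonsplitEquiv_mem_unipotentU_iff` + `heA`).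
[cite: Rogawski1990, §1.10 p. 9] [cite: PlatonovRapinchuk1994, §5.1] -/
theorem mem_cmBorelTriple_N_iff (g : Gqs L v) :
    g ∈ (cmBorelTriple L 3 v : ParabolicTriple (Gqs L v)).N ↔
      eA g ∈ unipotentU (galAdicCompletionMap (L := L) (IsCMField.complexConj L) hw) ((StdForm.antidiagonal 3).over (w.1.adicCompletion L)) :=
  (localNonsplitEquiv_mem_unipotentU_iff L v w hw g).symm.trans (by rw [mem_unipotentU_iff, mem_unipotentU_iff, heA])

/-- **Torus ↔ torus along `eA`**: `g ∈ T(L⁺_v) = (cmBorelTriple L 3 v).M ↔ eA g` is diagonal (★ `localNonsplitEquiv_mem_torusU_iff` + `heA`).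
[cite: Rogawski1990, §1.10 p. 9] [cite: PlatonovRapinchuk1994, §5.1] -/
theorem mem_cmBorelTriple_M_iff (g : Gqs L v) :
    g ∈ (cmBorelTriple L 3 v : ParabolicTriple (Gqs L v)).M ↔
      eA g ∈ torusU (galAdicCompletionMap (L := L) (IsCMField.complexConj L) hw) ((StdForm.antidiagonal 3).over (w.1.adicCompletion L)) :=
  (localNonsplitEquiv_mem_torusU_iff L v w hw g).symm.trans (by rw [mem_torusU_iff, mem_torusU_iff, heA])

/-- **Borel ↔ Borel along `eA`**: `g ∈ B(L⁺_v) = (cmBorelTriple L 3 v).P ↔ eA g` is upper triangular (entrywise at the single place `w ∣ v`, ★ `localNonsplitEquiv_apply_apply`).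
[cite: Rogawski1990, §1.10 p. 9] [cite: PlatonovRapinchuk1994, §5.1] -/
theorem mem_cmBorelTriple_P_iff (g : Gqs L v) :
    g ∈ (cmBorelTriple L 3 v : ParabolicTriple (Gqs L v)).P ↔
      eA g ∈ borelU (galAdicCompletionMap (L := L) (IsCMField.complexConj L) hw) ((StdForm.antidiagonal 3).over (w.1.adicCompletion L)) := by
  refine (mem_borelU_iff (σ := conjLocal L (IsCMField.complexConj L) v) (J := cmLocalForm L 3 v) g).trans ?_
  rw [mem_borelU_iff, heA]
  simp only [Matrix.BlockTriangular]
  refine forall_congr' fun i => forall_congr' fun j => imp_congr_right fun _ => ?_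
  rw [localNonsplitEquiv_apply_apply, ← apply_eq_zero_iff_apply_apply_eq_zero L v w hw]

end Transport

/-! ## §2 The torus letters at the datum: the translation `τ` (`eA τ = diag(ϖ, 1, ϖ⁻¹)`, `τ · A j = A (j+2)`) and the compact torus `T ∩ K₀` (fixes the apartment, commutes with `τ`) -/

section Torus

variable (L : Type) [Field L] [NumberField L] [IsCMField L] (v : HeightOneSpectrum (𝓞 ↥(maximalRealSubfield L)))
  (w : PlacesOver L v) (hw : IsCMField.complexConj L • w.1 = w.1) {ϖ : w.1.adicCompletion L}
  (hd : UnramifiedLocalConjDatum (galAdicCompletionMap (L := L) (IsCMField.complexConj L) hw) ϖ)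
  (eA : Gqs L v ≃ₜ* ↥(unitaryGroupOfForm (galAdicCompletionMap (L := L) (IsCMField.complexConj L) hw) ((StdForm.antidiagonal 3).over (w.1.adicCompletion L))))
  (heA : ∀ g : Gqs L v,
    ((eA g : ↥(unitaryGroupOfForm (galAdicCompletionMap (L := L) (IsCMField.complexConj L) hw) ((StdForm.antidiagonal 3).over (w.1.adicCompletion L)))) :
        GL (Fin 3) (w.1.adicCompletion L)) =
      ((localNonsplitEquiv (IsCMField.complexConj L) (qsForm L) (IsCMField.complexConj_ne_one L) w hw g :
        ↥(unitaryGroupOfForm (galAdicCompletionMap (L := L) (IsCMField.complexConj L) hw) (placeForm (qsForm L) w.1))) : GL (Fin 3) (w.1.adicCompletion L)))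
  {a : Gqs L v →* ((latticeGraph (galAdicCompletionMap (L := L) (IsCMField.complexConj L) hw) ϖ ((StdForm.antidiagonal 3).over (w.1.adicCompletion L))) ≃g
    (latticeGraph (galAdicCompletionMap (L := L) (IsCMField.complexConj L) hw) ϖ ((StdForm.antidiagonal 3).over (w.1.adicCompletion L))))}
  (ha : ∀ g, a g = latticeGraphIso (galAdicCompletionMap (L := L) (IsCMField.complexConj L) hw) ϖ ((StdForm.antidiagonal 3).over (w.1.adicCompletion L)) (eA g))
  (A : ℤ → {M : Submodule 𝒪[(w.1.adicCompletion L)] (Fin 3 → (w.1.adicCompletion L)) //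
    IsVertex (galAdicCompletionMap (L := L) (IsCMField.complexConj L) hw) ϖ ((StdForm.antidiagonal 3).over (w.1.adicCompletion L)) M})
  (hA0 : ∀ c : ℤ, (A (2 * c)).1 = latt (Matrix.diagonal ![ϖ ^ c, (1 : w.1.adicCompletion L), ϖ ^ (-c)]))
  (hA1 : ∀ c : ℤ, (A (2 * c + 1)).1 = latt (Matrix.diagonal ![ϖ ^ (c + 1), (1 : w.1.adicCompletion L), ϖ ^ (-c)]))

include hd heA ha hA0 hA1 in
/-- **THE TORUS TRANSLATION AT THE DATUM**: there is `τ ∈ T(L⁺_v) = (cmBorelTriple L 3 v).M` with model matrix `eA τ = diag(ϖ, 1, ϖ⁻¹)` translating the enumerated apartment by two: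
`τ · A j = A (j + 2)` (★ A-I (T) at `c = 1`, pulled back along `eA`).  The `τM ∕ hτM` letters of ★ 5b `sum_finrank_block_eigen_eq_of_tree`.
[cite: Rogawski1990, §1.10 p. 9] [cite: BruhatTits1972, §10] -/
theorem exists_mem_cmBorelTriple_M_apartmentEnum_eq_add_two :
    ∃ τ : Gqs L v, τ ∈ (cmBorelTriple L 3 v : ParabolicTriple (Gqs L v)).M ∧
      (((eA τ : ↥(unitaryGroupOfForm (galAdicCompletionMap (L := L) (IsCMField.complexConj L) hw) ((StdForm.antidiagonal 3).over (w.1.adicCompletion L)))) :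
          GL (Fin 3) (w.1.adicCompletion L)) : Matrix (Fin 3) (Fin 3) (w.1.adicCompletion L)) = Matrix.diagonal ![ϖ, 1, ϖ⁻¹] ∧
      ∀ j : ℤ, a τ (A j) = A (j + 2) := by
  obtain ⟨t, htT, htm, htA⟩ := exists_mem_torusU_latticeGraphIso_apartmentEnum_eq_add hd A hA0 hA1 1
  refine ⟨eA.symm t, ?_, ?_, fun j => ?_⟩
  · rw [mem_cmBorelTriple_M_iff L v w hw eA heA, ContinuousMulEquiv.apply_symm_apply]; exact htT
  · rw [ContinuousMulEquiv.apply_symm_apply, htm, zpow_one, zpow_neg, zpow_one]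
  · rw [ha, ContinuousMulEquiv.apply_symm_apply, htA, mul_one]

include heA in
/-- **`T(L⁺_v)` IS COMMUTATIVE** (diagonal matrices; ★ `mul_comm_of_mem_torusU` on the model, pulled back along `eA`) — the `hCτ` letter of ★ 5b. [cite: Rogawski1990, §1.10 p. 9] -/
theorem mul_comm_of_mem_cmBorelTriple_M {c τ : Gqs L v} (hc : c ∈ (cmBorelTriple L 3 v : ParabolicTriple (Gqs L v)).M)
    (hτ : τ ∈ (cmBorelTriple L 3 v : ParabolicTriple (Gqs L v)).M) : c * τ = τ * c := by
  apply eA.injective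
  rw [map_mul, map_mul]
  exact mul_comm_of_mem_torusU (galAdicCompletionMap (L := L) (IsCMField.complexConj L) hw)
    ((mem_cmBorelTriple_M_iff L v w hw eA heA c).1 hc) ((mem_cmBorelTriple_M_iff L v w hw eA heA τ).1 hτ)

include hd heA ha hA0 hA1 in
/-- **A TORUS ELEMENT FIXING ONE APARTMENT VERTEX FIXES THE WHOLE APARTMENT**: `c ∈ T(L⁺_v)`, `c · A 0 = A 0` ⇒ `c · A j = A j` for all `j` (★ A-II (H8₀): `eA c` translates the
apartment by some `2c′`, and `A (2c′) = A 0` forces `c′ = 0` by ★ `apartmentEnum_injective`).  With `C := T ∩ Stab(A 0)` this is the `hCR₀` letter of ★ 5b (and, endpoint-wise,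
`hCR₁`). [cite: BruhatTits1972, §10] [cite: Serre1980Trees, II.1.1; I.6.4] [cite: Rogawski1990, §1.10 p. 9] -/
theorem apartmentEnum_eq_self_of_mem_cmBorelTriple_M_of_apply_zero {c : Gqs L v} (hcM : c ∈ (cmBorelTriple L 3 v : ParabolicTriple (Gqs L v)).M)
    (hc0 : a c (A 0) = A 0) (j : ℤ) : a c (A j) = A j := by
  obtain ⟨c', hshift, -⟩ := exists_forall_latticeGraphIso_apartmentEnum_eq_add_of_mem_torusU hd A hA0 hA1 ((mem_cmBorelTriple_M_iff L v w hw eA heA c).1 hcM)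
  have h0 := hshift 0
  rw [← ha, hc0, zero_add] at h0
  have hc' : c' = 0 := by have := apartmentEnum_injective hd A hA0 hA1 h0; omega
  rw [ha, hshift j, hc', mul_zero, add_zero]

include hd heA ha hA0 hA1 in
/-- The apartment EDGES `{A j, A (j+1)}` are fixed (as elements of `edgeSet`) by a torus element fixing `A 0`. [cite: BruhatTits1972, §10] [cite: Serre1980Trees, II.1.1] -/
theorem mapEdgeSet_apartmentEnum_eq_self_of_mem_cmBorelTriple_M_of_apply_zero {c : Gqs L v} (hcM : c ∈ (cmBorelTriple L 3 v : ParabolicTriple (Gqs L v)).M)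
    (hc0 : a c (A 0) = A 0) (j : ℤ) :
    (a c).mapEdgeSet ⟨s(A j, A (j + 1)), (SimpleGraph.mem_edgeSet _).2 (latticeGraph_adj_apartmentEnum_succ hd A hA0 hA1 j)⟩ =
      ⟨s(A j, A (j + 1)), (SimpleGraph.mem_edgeSet _).2 (latticeGraph_adj_apartmentEnum_succ hd A hA0 hA1 j)⟩ := by
  apply Subtype.ext
  change Sym2.map (a c) s(A j, A (j + 1)) = s(A j, A (j + 1))
  rw [Sym2.map_mk, apartmentEnum_eq_self_of_mem_cmBorelTriple_M_of_apply_zero L v w hw hd eA heA ha A hA0 hA1 hcM hc0 j,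
    apartmentEnum_eq_self_of_mem_cmBorelTriple_M_of_apply_zero L v w hw hd eA heA ha A hA0 hA1 hcM hc0 (j + 1)]

include heA ha in
/-- **`T ∩ Stab(A 0)` IS COMPACT** in `Gqs L v`: the stabiliser of a vertex is compact (★ `isCompact_setOf_latticeGraphIso_apply_eq` along `eA`) and `T` is closed (★
`isClosed_torusU_of_t1Space` along `eA`) — the `hC` letter of ★ 5b and of the (α) MACKEY packages. [cite: BruhatTits1972, §10] [cite: Rogawski1990, §1.10 p. 9] -/
theorem isCompact_cmBorelTriple_M_inf (P₀ : Subgroup (Gqs L v))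
    (x₀ : {M : Submodule 𝒪[(w.1.adicCompletion L)] (Fin 3 → (w.1.adicCompletion L)) //
      IsVertex (galAdicCompletionMap (L := L) (IsCMField.complexConj L) hw) ϖ ((StdForm.antidiagonal 3).over (w.1.adicCompletion L)) M})
    (hP₀ : ∀ g, g ∈ P₀ ↔ a g x₀ = x₀) :
    IsCompact (((cmBorelTriple L 3 v : ParabolicTriple (Gqs L v)).M ⊓ P₀ : Subgroup (Gqs L v)) : Set (Gqs L v)) := by
  haveI := compactSpace_integer_adicCompletion L w.1
  have hPc : IsCompact (P₀ : Set (Gqs L v)) := by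
    have hpre : (P₀ : Set (Gqs L v)) = eA ⁻¹' {u | latticeGraphIso (galAdicCompletionMap (L := L) (IsCMField.complexConj L) hw) ϖ ((StdForm.antidiagonal 3).over (w.1.adicCompletion L)) u x₀ = x₀} := by
      ext g; simp only [SetLike.mem_coe, hP₀, Set.mem_preimage, Set.mem_setOf_eq, ha]
    rw [hpre]
    exact eA.toHomeomorph.isCompact_preimage.2 (isCompact_setOf_latticeGraphIso_apply_eq (galAdicCompletionMap (L := L) (IsCMField.complexConj L) hw) ϖ
      ((StdForm.antidiagonal 3).over (w.1.adicCompletion L)) (continuous_galAdicCompletionMap L (IsCMField.complexConj L) hw) x₀)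
  have hMc : IsClosed (eA ⁻¹' (torusU (galAdicCompletionMap (L := L) (IsCMField.complexConj L) hw) ((StdForm.antidiagonal 3).over (w.1.adicCompletion L)) : Set _)) :=
    (isClosed_torusU_of_t1Space _ _).preimage eA.continuous
  have hset : (((cmBorelTriple L 3 v : ParabolicTriple (Gqs L v)).M ⊓ P₀ : Subgroup (Gqs L v)) : Set (Gqs L v)) =
      eA ⁻¹' (torusU (galAdicCompletionMap (L := L) (IsCMField.complexConj L) hw) ((StdForm.antidiagonal 3).over (w.1.adicCompletion L)) : Set _) ∩ (P₀ : Set (Gqs L v)) := by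
    ext g
    simp only [SetLike.mem_coe, Set.mem_inter_iff, Set.mem_preimage]
    constructor
    · rintro ⟨h1, h2⟩; exact ⟨(mem_cmBorelTriple_M_iff L v w hw eA heA g).1 h1, h2⟩
    · rintro ⟨h1, h2⟩; exact ⟨(mem_cmBorelTriple_M_iff L v w hw eA heA g).2 h1, h2⟩
  rw [hset]
  exact hPc.inter_left hMc

end Torus

/-! ## §3 THE HOROCYCLE INDEX AT THE DATUM: every vertex ∕ edge is `n · A j` ∕ `n · {A j, A (j+1)}` with `n ∈ N(L⁺_v)` and a UNIQUE, `N`-invariant index `j` -/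

section Horocycle

variable (L : Type) [Field L] [NumberField L] [IsCMField L] (v : HeightOneSpectrum (𝓞 ↥(maximalRealSubfield L)))
  (w : PlacesOver L v) (hw : IsCMField.complexConj L • w.1 = w.1) {ϖ : w.1.adicCompletion L}
  (hd : UnramifiedLocalConjDatum (galAdicCompletionMap (L := L) (IsCMField.complexConj L) hw) ϖ)
  (eA : Gqs L v ≃ₜ* ↥(unitaryGroupOfForm (galAdicCompletionMap (L := L) (IsCMField.complexConj L) hw) ((StdForm.antidiagonal 3).over (w.1.adicCompletion L))))
  (heA : ∀ g : Gqs L v,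
    ((eA g : ↥(unitaryGroupOfForm (galAdicCompletionMap (L := L) (IsCMField.complexConj L) hw) ((StdForm.antidiagonal 3).over (w.1.adicCompletion L)))) :
        GL (Fin 3) (w.1.adicCompletion L)) =
      ((localNonsplitEquiv (IsCMField.complexConj L) (qsForm L) (IsCMField.complexConj_ne_one L) w hw g :
        ↥(unitaryGroupOfForm (galAdicCompletionMap (L := L) (IsCMField.complexConj L) hw) (placeForm (qsForm L) w.1))) : GL (Fin 3) (w.1.adicCompletion L)))
  {a : Gqs L v →* ((latticeGraph (galAdicCompletionMap (L := L) (IsCMField.complexConj L) hw) ϖ ((StdForm.antidiagonal 3).over (w.1.adicCompletion L))) ≃g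
    (latticeGraph (galAdicCompletionMap (L := L) (IsCMField.complexConj L) hw) ϖ ((StdForm.antidiagonal 3).over (w.1.adicCompletion L))))}
  (ha : ∀ g, a g = latticeGraphIso (galAdicCompletionMap (L := L) (IsCMField.complexConj L) hw) ϖ ((StdForm.antidiagonal 3).over (w.1.adicCompletion L)) (eA g))
  (A : ℤ → {M : Submodule 𝒪[(w.1.adicCompletion L)] (Fin 3 → (w.1.adicCompletion L)) //
    IsVertex (galAdicCompletionMap (L := L) (IsCMField.complexConj L) hw) ϖ ((StdForm.antidiagonal 3).over (w.1.adicCompletion L)) M})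
  (hA0 : ∀ c : ℤ, (A (2 * c)).1 = latt (Matrix.diagonal ![ϖ ^ c, (1 : w.1.adicCompletion L), ϖ ^ (-c)]))
  (hA1 : ∀ c : ℤ, (A (2 * c + 1)).1 = latt (Matrix.diagonal ![ϖ ^ (c + 1), (1 : w.1.adicCompletion L), ϖ ^ (-c)]))

include ha in
/-- `mapEdgeSet` is multiplicative along the action `a`. [cite: Serre1980Trees, II.1.1] -/
theorem mapEdgeSet_actionHom_mul (g g' : Gqs L v) (d : (latticeGraph (galAdicCompletionMap (L := L) (IsCMField.complexConj L) hw) ϖ ((StdForm.antidiagonal 3).over (w.1.adicCompletion L))).edgeSet) :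
    (a (g * g')).mapEdgeSet d = (a g).mapEdgeSet ((a g').mapEdgeSet d) := by
  apply Subtype.ext
  change Sym2.map (a (g * g')) d.1 = Sym2.map (a g) (Sym2.map (a g') d.1)
  rw [Sym2.map_map]
  congr 1
  funext x
  simp only [Function.comp_apply, ha, map_mul, latticeGraphIso_mul_apply]

include hd heA ha hA0 hA1 in
/-- **(X1v) THE HOROCYCLE INDEX OF A VERTEX AT THE DATUM**: functions `idx : 𝓥 → ℤ`, `tr : 𝓥 → N(L⁺_v)` with `tr x · A (idx x) = x`, `idx` invariant under `N(L⁺_v)` and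
`idx (A j) = j` (★ A-II (H5)(H6!) pulled back along `eA`).  The `rep₀ := A ∘ idx`, `tr₀ := tr`, `hrep_act₀`, `hrep_id₀` letters of ★ FILE 3∕4∕5b.
[cite: BruhatTits1972, §10] [cite: Serre1980Trees, II.1.1] [cite: Rogawski1990, §4.5 p. 45] -/
theorem exists_horocycleIndex_vertices :
    ∃ (idx : {M : Submodule 𝒪[(w.1.adicCompletion L)] (Fin 3 → (w.1.adicCompletion L)) //
        IsVertex (galAdicCompletionMap (L := L) (IsCMField.complexConj L) hw) ϖ ((StdForm.antidiagonal 3).over (w.1.adicCompletion L)) M} → ℤ)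
      (tr : {M : Submodule 𝒪[(w.1.adicCompletion L)] (Fin 3 → (w.1.adicCompletion L)) //
        IsVertex (galAdicCompletionMap (L := L) (IsCMField.complexConj L) hw) ϖ ((StdForm.antidiagonal 3).over (w.1.adicCompletion L)) M} → Gqs L v),
      (∀ x, tr x ∈ (cmBorelTriple L 3 v : ParabolicTriple (Gqs L v)).N) ∧ (∀ x, a (tr x) (A (idx x)) = x) ∧
      (∀ n ∈ (cmBorelTriple L 3 v : ParabolicTriple (Gqs L v)).N, ∀ x, idx (a n x) = idx x) ∧ (∀ j : ℤ, idx (A j) = j) := by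
  have hex := fun x => exists_mem_unipotentU_latticeGraphIso_apartmentEnum_eq hd A hA0 hA1 x
  choose n hn j hj using hex
  refine ⟨j, fun x => eA.symm (n x), fun x => ?_, fun x => ?_, fun g hg x => ?_, fun i => ?_⟩
  · rw [mem_cmBorelTriple_N_iff L v w hw eA heA, ContinuousMulEquiv.apply_symm_apply]; exact hn x
  · rw [ha, ContinuousMulEquiv.apply_symm_apply]; exact hj x
  · have hg' := (mem_cmBorelTriple_N_iff L v w hw eA heA g).1 hg
    have h1 : latticeGraphIso (galAdicCompletionMap (L := L) (IsCMField.complexConj L) hw) ϖ ((StdForm.antidiagonal 3).over (w.1.adicCompletion L))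
        (eA g * n x) (A (j x)) = a g x := by
      rw [latticeGraphIso_mul_apply, hj x, ha]
    exact eq_of_mem_unipotentU_of_latticeGraphIso_apartmentEnum_eq₂ hd A hA0 hA1 (hn (a g x)) (mul_mem hg' (hn x)) ((hj (a g x)).trans h1.symm)
  · exact eq_of_mem_unipotentU_of_latticeGraphIso_apartmentEnum_eq₂ hd A hA0 hA1 (hn (A i)) (one_mem _)
      ((hj (A i)).trans (latticeGraphIso_one_apply _).symm)

include hd heA ha hA0 hA1 in
set_option maxHeartbeats 1600000 in  -- statement-level `whnf` on the datum edge type `⟨s(A j, A (j+1)), _⟩` over the CM carriers (the 41g-H ∕ 48-datum wall; measured: fails at 200000)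
/-- **(X1e) THE HOROCYCLE INDEX OF AN EDGE AT THE DATUM**: `idx₁ : 𝓔 → ℤ`, `tr₁ : 𝓔 → N(L⁺_v)` with `tr₁ d · {A (idx₁ d), A (idx₁ d + 1)} = d`, `idx₁` invariant under
`N(L⁺_v)`, `idx₁ {A j, A (j+1)} = j` (★ A-II (H7e)(H7!e) along `eA`).  The `rep₁ tr₁ hrep_act₁ hrep_id₁` letters of ★ FILE 4∕5b (`act₁ g := (a g).mapEdgeSet`).
[cite: BruhatTits1972, §10] [cite: Serre1980Trees, II.1.1] -/
theorem exists_horocycleIndex_edges :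
    ∃ (idx₁ : (latticeGraph (galAdicCompletionMap (L := L) (IsCMField.complexConj L) hw) ϖ ((StdForm.antidiagonal 3).over (w.1.adicCompletion L))).edgeSet → ℤ)
      (tr₁ : (latticeGraph (galAdicCompletionMap (L := L) (IsCMField.complexConj L) hw) ϖ ((StdForm.antidiagonal 3).over (w.1.adicCompletion L))).edgeSet → Gqs L v),
      (∀ d, tr₁ d ∈ (cmBorelTriple L 3 v : ParabolicTriple (Gqs L v)).N) ∧
      (∀ d, (a (tr₁ d)).mapEdgeSet ⟨s(A (idx₁ d), A (idx₁ d + 1)), (SimpleGraph.mem_edgeSet _).2 (latticeGraph_adj_apartmentEnum_succ hd A hA0 hA1 (idx₁ d))⟩ = d) ∧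
      (∀ n ∈ (cmBorelTriple L 3 v : ParabolicTriple (Gqs L v)).N, ∀ d, idx₁ ((a n).mapEdgeSet d) = idx₁ d) ∧
      (∀ j : ℤ, idx₁ ⟨s(A j, A (j + 1)), (SimpleGraph.mem_edgeSet _).2 (latticeGraph_adj_apartmentEnum_succ hd A hA0 hA1 j)⟩ = j) := by
  have hex := fun d => exists_mem_unipotentU_mapEdgeSet_apartmentEnum_eq hd A hA0 hA1 d
  choose n hn j hj using hex
  refine ⟨j, fun d => eA.symm (n d), fun d => ?_, fun d => ?_, fun g hg d => ?_, fun i => ?_⟩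
  · rw [mem_cmBorelTriple_N_iff L v w hw eA heA, ContinuousMulEquiv.apply_symm_apply]; exact hn d
  · rw [ha, ContinuousMulEquiv.apply_symm_apply]; exact hj d
  · have hg' := (mem_cmBorelTriple_N_iff L v w hw eA heA g).1 hg
    have h1 : (latticeGraphIso (galAdicCompletionMap (L := L) (IsCMField.complexConj L) hw) ϖ ((StdForm.antidiagonal 3).over (w.1.adicCompletion L))
        (eA g * n d)).mapEdgeSet ⟨s(A (j d), A (j d + 1)), (SimpleGraph.mem_edgeSet _).2 (latticeGraph_adj_apartmentEnum_succ hd A hA0 hA1 (j d))⟩ = (a g).mapEdgeSet d := by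
      rw [← ContinuousMulEquiv.apply_symm_apply eA (n d), ← map_mul, ← ha, mapEdgeSet_actionHom_mul L v w hw eA ha, ha (eA.symm (n d)),
        ContinuousMulEquiv.apply_symm_apply, hj d]
    exact eq_of_mem_unipotentU_of_mapEdgeSet_apartmentEnum_eq hd A hA0 hA1 (hn ((a g).mapEdgeSet d)) (mul_mem hg' (hn d)) ((hj ((a g).mapEdgeSet d)).trans h1.symm)
  · refine eq_of_mem_unipotentU_of_mapEdgeSet_apartmentEnum_eq hd A hA0 hA1 (hn _) (one_mem _) ((hj _).trans ?_)
    apply Subtype.ext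
    change _ = Sym2.map (latticeGraphIso (galAdicCompletionMap (L := L) (IsCMField.complexConj L) hw) ϖ ((StdForm.antidiagonal 3).over (w.1.adicCompletion L)) 1) s(A i, A (i + 1))
    rw [Sym2.map_mk, latticeGraphIso_one_apply, latticeGraphIso_one_apply]

end Horocycle


end Summit.HodgeConjecture.HodgeConjecture.Cruxes.H413.F0P3cStCharTSHorocyclesAtDatum

end
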